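import Summits.CriticalPhenomena.PercolationContinuityZ3.Theorems.PercNearOneGluingAdditiveGluingTiedRaiseRates
import HarnessLib

/-!
# Crux `PercNearOneGluing.AdditiveGluing` (stmt-CriticalPhenomena-4576): existence of a TIE-PRESERVING direction for three tied relays (DIR₃)

Support file (`--supports stmt-CriticalPhenomena-4576`, lead prim-png-lead-4576).  No definitions, no named facts, no sorries.

At a three-way tie `τ(a₁) = τ(a₂) = τ(a₃)` with the three internal weights `< 1`, there are nonnegative, not all zero, weights
`x₁₂, x₁₃, x₂₃` on the internal pairs under which the three relays gain reliability at a common rate `ρ` (so that raising the pairs in the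
proportion `x` keeps the tie to first order).  With `π_e` the common rate of the tied pair `e` (`tiedRaise_rate_eq_of_tie`) and `κ_k(e) ≤ π_e`
the rate of the third relay (Kozma–Nitzan Lemma 4 in rate form, `tiedRaise_rate_le`), `δ_e := π_e − κ_ē(e) ≥ 0` and one may take
`x_e = Π_{e' ≠ e} δ_{e'}` when all `δ_e > 0`, and the coordinate direction `1_e` when `δ_e = 0`.  This is hypothesis DIR₃ of the lead's
zigzag reduction (crux evidence REDUCTION-TRL.md, §1 and §3').  [cite: KozmaNitzan2024, Lemma 4 (p. 9)]
-/

namespace Summit.CriticalPhenomena.PercolationContinuityZ3.Theorems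

open MeasureTheory Set Literature.Probability.LatticeModels Literature.Probability.Percolation

noncomputable section
open Classical

variable {n : ℕ}

/-- Real-arithmetic core of `tiedRaise_dir_three`: existence of a nonnegative nonzero weight vector equalising three rates. -/
theorem tiedRaise_dir_core (p12 p12' k3 p13 p13' k2 p23 p23' k1 : ℝ)
    (c12 : p12 = p12') (c13 : p13 = p13') (c23 : p23 = p23')
    (d12 : k3 ≤ p12) (d13 : k2 ≤ p13) (d23 : k1 ≤ p23) :
    ∃ x12 x13 x23 ρ : ℝ, 0 ≤ x12 ∧ 0 ≤ x13 ∧ 0 ≤ x23 ∧ 0 < x12 + x13 + x23 ∧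
      x12 * p12 + x13 * p13 + x23 * k1 = ρ ∧
      x12 * p12' + x13 * k2 + x23 * p23 = ρ ∧
      x12 * k3 + x13 * p13' + x23 * p23' = ρ := by
  subst c12 c13 c23
  by_cases h12 : k3 = p12
  · exact ⟨1, 0, 0, p12, by norm_num, le_rfl, le_rfl, by norm_num, by ring, by ring, by rw [h12]; ring⟩
  by_cases h13 : k2 = p13
  · exact ⟨0, 1, 0, p13, le_rfl, by norm_num, le_rfl, by norm_num, by ring, by rw [h13]; ring, by ring⟩
  by_cases h23 : k1 = p23
  · exact ⟨0, 0, 1, p23, le_rfl, le_rfl, by norm_num, by norm_num, by rw [h23]; ring, by ring, by ring⟩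
  have e12 : 0 < p12 - k3 := sub_pos.mpr (lt_of_le_of_ne d12 h12)
  have e13 : 0 < p13 - k2 := sub_pos.mpr (lt_of_le_of_ne d13 h13)
  have e23 : 0 < p23 - k1 := sub_pos.mpr (lt_of_le_of_ne d23 h23)
  refine ⟨(p13 - k2) * (p23 - k1), (p12 - k3) * (p23 - k1), (p12 - k3) * (p13 - k2),
    (p13 - k2) * (p23 - k1) * p12 + (p12 - k3) * (p23 - k1) * p13 + (p12 - k3) * (p13 - k2) * k1,
    by positivity, by positivity, by positivity, by positivity, by ring, by ring, by ring⟩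

/-- **DIR₃: a tie-preserving direction exists for three tied relays.**  See the file header. [cite: KozmaNitzan2024, Lemma 4 (p. 9)] -/
theorem tiedRaise_dir_three (w : Sym2 (Fin n) → unitInterval) (b a₁ a₂ a₃ : Fin n)
    (h12 : a₁ ≠ a₂) (h13 : a₁ ≠ a₃) (h23 : a₂ ≠ a₃)
    (ht12 : (prodBernoulli w).real (openConn a₁ b) = (prodBernoulli w).real (openConn a₂ b))
    (ht13 : (prodBernoulli w).real (openConn a₁ b) = (prodBernoulli w).real (openConn a₃ b))
    (hw12 : (w s(a₁, a₂) : ℝ) < 1) (hw13 : (w s(a₁, a₃) : ℝ) < 1) (hw23 : (w s(a₂, a₃) : ℝ) < 1) :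
    ∃ x₁₂ x₁₃ x₂₃ ρ : ℝ, 0 ≤ x₁₂ ∧ 0 ≤ x₁₃ ∧ 0 ≤ x₂₃ ∧ 0 < x₁₂ + x₁₃ + x₂₃ ∧
      x₁₂ * ((prodBernoulli (Function.update w s(a₁, a₂) 1)).real (openConn a₁ b) - (prodBernoulli (Function.update w s(a₁, a₂) 0)).real (openConn a₁ b)) + x₁₃ * ((prodBernoulli (Function.update w s(a₁, a₃) 1)).real (openConn a₁ b) - (prodBernoulli (Function.update w s(a₁, a₃) 0)).real (openConn a₁ b)) + x₂₃ * ((prodBernoulli (Function.update w s(a₂, a₃) 1)).real (openConn a₁ b) - (prodBernoulli (Function.update w s(a₂, a₃) 0)).real (openConn a₁ b)) = ρ ∧ x₁₂ * ((prodBernoulli (Function.update w s(a₁, a₂) 1)).real (openConn a₂ b) - (prodBernoulli (Function.update w s(a₁, a₂) 0)).real (openConn a₂ b)) + x₁₃ * ((prodBernoulli (Function.update w s(a₁, a₃) 1)).real (openConn a₂ b) - (prodBernoulli (Function.update w s(a₁, a₃) 0)).real (openConn a₂ b)) + x₂₃ * ((prodBernoulli (Function.update w s(a₂, a₃) 1)).real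 (openConn a₂ b) - (prodBernoulli (Function.update w s(a₂, a₃) 0)).real (openConn a₂ b)) = ρ ∧ x₁₂ * ((prodBernoulli (Function.update w s(a₁, a₂) 1)).real (openConn a₃ b) - (prodBernoulli (Function.update w s(a₁, a₂) 0)).real (openConn a₃ b)) + x₁₃ * ((prodBernoulli (Function.update w s(a₁, a₃) 1)).real (openConn a₃ b) - (prodBernoulli (Function.update w s(a₁, a₃) 0)).real (openConn a₃ b)) + x₂₃ * ((prodBernoulli (Function.update w s(a₂, a₃) 1)).real (openConn a₃ b) - (prodBernoulli (Function.update w s(a₂, a₃) 0)).real (openConn a₃ b)) = ρ := by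
  have ht23 : (prodBernoulli w).real (openConn a₂ b) = (prodBernoulli w).real (openConn a₃ b) := by rw [← ht12, ht13]
  -- common rates of the tied pairs
  have c12 := tiedRaise_rate_eq_of_tie w h12 b ht12 hw12
  have c13 := tiedRaise_rate_eq_of_tie w h13 b ht13 hw13
  have c23 := tiedRaise_rate_eq_of_tie w h23 b ht23 hw23
  -- the third relay gains at most at the pair's rate (Lemma 4)
  have d12 := tiedRaise_rate_le w h12 a₃ b ht12.le hw12
  have d13 := tiedRaise_rate_le w h13 a₂ b ht13.le hw13
  have d23 := tiedRaise_rate_le w h23 a₁ b ht23.le hw23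
  exact tiedRaise_dir_core _ _ _ _ _ _ _ _ _ c12 c13 c23 d12 d13 d23

end

end Summit.CriticalPhenomena.PercolationContinuityZ3.Theorems
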